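import Literature.AlgebraicGeometry.Hironaka2017.S13GLUEDDiagram.R015GlobalTails
import Literature.AlgebraicGeometry.Hironaka2017.S04CharAlgebra.R003PAlgebra
import Literature.AlgebraicGeometry.Hironaka2017.S09LLUED.R063Tails
import Mathlib.Algebra.CharP.Lemmas
import HarnessLib

/-!
# [OURS · L1 W1.3] Architecture bypass: Def 13.2's tails module WITHOUT the `℘nega` summand (v1: objects + claim schema)

LADDER-RESOLUTION rung L (rescue), cell `res-hironaka` (run/shared/lean/pub/res-hironaka/), slot **W1.3** of
plan/RESCUE-SEED.md §1 L-G1 («ARCHITECTURE BYPASS: drop `℘nega` — define `T♯ := 𝔏_0(∞) ∩ ℘posi` (the other summand of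
Def 13.2) and check whether §§14–16 ever consume more; if the résumé / tails / (127) strings are unchanged on all
recorded examples, the collapse is NON-PROPAGATING»). AUTHORITY for file name, host item and typer: plan/SIZED-ASK-L.md
§4 paragraph S-s11/S-s12/S-s13 (res-plan-2): «`…CampaignW13Bypass.lean` (def T♯_bypass := L0(∞) ∩ ℘posi over
`S13.Def13_2` + Prop `CampaignW13BypassInvariance` = résumé / tails / (127) data unchanged on a stated class containing
examples B / C / D) … HOST: MarkedTransfer `--supports stmt-ResolutionOfSingularities-15522` (`HypersurfaceToMarked`)
… TYPER / LANES: type-o2». OURS objects, SUMMIT-SIDE (director-resolution 2026-08-26T15:23:05Z), statement-only lane,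
typer res-L1-type-o2. This is v1 = the OBJECTS and the SCHEMA of the invariance claim; the campaign statement proper
(`CampaignW13BypassInvariance`: the instance class containing examples B/C/D and the chosen downstream readers) is
res-L1-s13-plan-1's to file as a rank-9 item and is NOT in this file — typed ahead of that hand-over because kill test
K1.3 (res-L1-k13, seated 2026-08-26T17:25Z) computes with `T♯_bypass` now and should share one decl with the campaign.

HONEST FRAMING. Nothing in this file is a statement of H. Hironaka's manuscript *Resolution of singularities in
positive characteristics* (2017-03-23, [Hironaka2017], lit key `paper:url-3343fd9e678b`), nothing here asserts or
denies any statement of it, and nothing here is progress on resolution of singularities in positive characteristic.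
Def 13.2 (p.67 L16–L22 of HOME/lit/layout/p0067.txt, render p0067.png: (105) `𝔗♯(Ě) = (𝔏_0(∞) ∩ ℘posi) + ℘nega`,
`𝔗♭(Ě) = ∥𝔗♯(Ě)∥ ⊂ O_Z`, (106) `Cot(Ě) = (𝔗♭(Ě) ∩ ρ^e(O))^{1/q}`, `q = p^e`) is TYPED — not asserted — by PARTITION
row 015 as the PARAMETRIC ring-level carrier `Literature.AlgebraicGeometry.Hironaka2017.S13GLUEDDiagram.{TSharp,
TFlat, Cot}` (parameters `L0inf pposi pnega : S11CoordFree.BlSub O p ℓ` = `ρ^ℓ(O)`-submodules of `Bl(Z) = O[T;T⁻¹]`,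
p.63 L15–L18). This file instantiates the `pnega` parameter with `⊥` and names the resulting objects; whether §§14–16
«consume more» than `𝔏_0(∞) ∩ ℘posi` is the campaign's question (s13 / K1.3), not settled here. RESCUE-SEED's caveat is
carried verbatim in substance: W1.3 can come out NON-PROPAGATING and STILL leave L-G4 (Eq. (127) / termination) open —
catalogued barrier `Literature.Barriers.ResolutionOfSingularities.KangarooShadeIncrease` (Hauser2003_kangarooShadeIncrease)
bounds any order-type reading of the tails. No barrier of the catalogue addresses the ℘-calculus itself («technique
class outside the catalogue», SIZED-ASK-L l.154). AI transcription/typing is weaker than expert review.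

## Contents (definitions + lattice-level identities; no claim about the manuscript)
* `Campaign.bypassTSharp`, `Campaign.bypassTFlat`, `Campaign.bypassCot` — Def 13.2's three objects with the `℘nega`
  summand dropped (row 015's carriers at `pnega := ⊥`).
* `Campaign.bypassTSharp_eq_inf` — `bypassTSharp L0inf pposi = L0inf ⊓ pposi` (the printed first summand, literally);
  `Campaign.bypassTSharp_le` — it sits inside Def 13.2's `𝔗♯` for every `℘nega` parameter.
* `Campaign.BypassInvariant` — the SCHEMA of the slot's claim: a downstream reader `F` of the tails module (a
  parameter: θ-images (108)/(109)/(112) of §14, résumé Def 15.8, Invmax-string (127)) takes the same value on Def 13.2's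
  `𝔗♯` and on the bypass `𝔗♯`; stated, not claimed; `Campaign.bypassInvariant_bot` records the degenerate instance.
-/

noncomputable section

set_option linter.dupNamespace false -- mandated namespace of this single-conjunct summit

namespace Summit.ResolutionOfSingularities.ResolutionOfSingularities.Theorems.Campaign

open Literature.AlgebraicGeometry.Hironaka2017
open Literature.AlgebraicGeometry.Hironaka2017.S11CoordFree (BlSub)

universe v

variable {O : Type v} [CommRing O] {p : ℕ} [Fact p.Prime] [CharP O p] {ℓ : ℕ}

/-- [OURS · L1 W1.3] replaces the role of Def 13.2 Eq. (105) `𝔗♯(Ě) = (𝔏_0(∞) ∩ ℘posi) + ℘nega` (p.67 L16–L18);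
NOT a statement of the manuscript. The BYPASS sharp tails module: row 015's `S13GLUEDDiagram.TSharp` with the
`℘nega` summand instantiated by `⊥`, i.e. `𝔏_0(∞) ∩ ℘posi` alone (`bypassTSharp_eq_inf`). Parameters `L0inf`
(«𝔏_0(∞)», the last module of diagram (104)) and `pposi` («℘posi(Ě)» inside `Bl(Z)`) exactly as in row 015.
VACUITY: not trivially `⊥`/`⊤` — it is the meet of two parameters. [folklore] -/
def bypassTSharp (L0inf pposi : BlSub O p ℓ) : BlSub O p ℓ :=
  S13GLUEDDiagram.TSharp L0inf pposi ⊥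

/-- The bypass sharp module is literally the printed first summand `𝔏_0(∞) ∩ ℘posi`. [folklore] -/
theorem bypassTSharp_eq_inf (L0inf pposi : BlSub O p ℓ) : bypassTSharp L0inf pposi = L0inf ⊓ pposi := by
  simp [bypassTSharp, S13GLUEDDiagram.TSharp]

/-- The bypass sharp module sits inside Def 13.2's `𝔗♯` for every choice of the `℘nega` parameter (monotonicity of
`⊔`; pure lattice algebra). [folklore] -/
theorem bypassTSharp_le (L0inf pposi pnega : BlSub O p ℓ) :
    bypassTSharp L0inf pposi ≤ S13GLUEDDiagram.TSharp L0inf pposi pnega := by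
  simp [bypassTSharp, S13GLUEDDiagram.TSharp]

/-- [OURS · L1 W1.3] replaces the role of Def 13.2 `𝔗♭(Ě) = ∥𝔗♯(Ě)∥ ⊂ O_Z` (p.67 L19); NOT a statement of the
manuscript. Row 015's `S13GLUEDDiagram.TFlat` (degree-forgotten image via row 076's `fnorm`) with `pnega := ⊥`.
[folklore] -/
def bypassTFlat (L0inf pposi : BlSub O p ℓ) : Submodule (↥(iterateFrobenius O p ℓ).range) O :=
  S13GLUEDDiagram.TFlat L0inf pposi ⊥

/-- [OURS · L1 W1.3] replaces the role of Def 13.2 Eq. (106) `Cot(Ě) = (𝔗♭(Ě) ∩ ρ^e(O))^{1/q}`, `q = p^e`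
(p.67 L20–L22); NOT a statement of the manuscript. Row 015's `S13GLUEDDiagram.Cot` with `pnega := ⊥`. [folklore] -/
def bypassCot (e : ℕ) (L0inf pposi : BlSub O p ℓ) : AddSubgroup O :=
  S13GLUEDDiagram.Cot e L0inf pposi ⊥

/-- Unfolding (by `rfl`): `bypassTFlat` is row 015's `TFlat` at `pnega = ⊥`. [folklore] -/
theorem bypassTFlat_eq (L0inf pposi : BlSub O p ℓ) :
    bypassTFlat L0inf pposi = S13GLUEDDiagram.TFlat L0inf pposi ⊥ :=
  rfl

/-- [OURS · L1 W1.3] SCHEMA of the slot's invariance claim `CampaignW13BypassInvariance` (RESCUE-SEED W1.3: «the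
résumé / tails / (127) strings are unchanged»): a downstream construction `F` on sub-objects of `Bl(Z)` — a
PARAMETER standing for the typed §14/§15/§16 readers of `𝔗♯(Ě)` (θ-images (108)/(109)/(112), résumé Def 15.8,
Invmax-string (127)) — returns the same value on Def 13.2's `𝔗♯(Ě)` and on the bypass module. Which `F`, which
instances, and whether it holds is the s13 campaign / kill test K1.3 — NOT asserted here. VACUITY: trivially true
for constant `F` and for `pnega = ⊥`; the campaign item must name a non-degenerate `F` and the printed `℘nega`.
[folklore] -/
def BypassInvariant {α : Sort*} (F : BlSub O p ℓ → α) (L0inf pposi pnega : BlSub O p ℓ) : Prop :=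
  F (S13GLUEDDiagram.TSharp L0inf pposi pnega) = F (bypassTSharp L0inf pposi)

/-- Sanity (the degenerate instance named in the VACUITY note): with `pnega = ⊥` the schema holds for every `F`.
[folklore] -/
theorem bypassInvariant_bot {α : Sort*} (F : BlSub O p ℓ → α) (L0inf pposi : BlSub O p ℓ) :
    BypassInvariant F L0inf pposi ⊥ :=
  rfl

/-! ## v2 (append-only): the SECONDARY reading «R-flat» registered by kill test K1.3

res-L1-k13's pre-registration (HOME/L/res-L1-k13/PREREG-K1.3.md, STATUS 2026-08-26T18:35:18Z) runs the bypass under TWO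
sub-readings of Def 13.2, because (105) is a sum of GRADED submodules followed by `∥·∥`: R-hom (PRIMARY, literal:
degreewise intersection inside `Bl(Z)` first, then `∥·∥` — this is `bypassTFlat` above) and R-flat (SECONDARY,
charitable: forget degrees first, then intersect with `∥℘posi(Ě)∥ = ℘(Ě,1)` — using `℘(Ě,b+1) ⊂ ℘(Ě,b)`, Th 4.5 p.18
L7–L8 (statement; L9–L14 its printed proof), typed `S04CharAlgebra.Thm4_5`, quoted for scope). One decl per reading
(README §3 T5 / protocol M4); which
reading the campaign statement uses is res-L1-s13-plan-1's call. Nothing below is a statement of the manuscript. -/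

/-- [OURS · L1 W1.3, reading R-flat] replaces the role of Def 13.2 `𝔗♭(Ě) = ∥𝔗♯(Ě)∥` (p.67 L19) under the bypass, in
the degree-forgetting order: `𝔗♭_flat := ∥𝔏_0(∞)∥ ∩ ℘(Ě,1)` — row 076's `S12GLUED.fnorm` («∥·∥», Eq. (98) p.65)
applied to `𝔏_0(∞)` FIRST, then met with the ideal `P1 = ℘(Ě,1)` (a parameter; I-P row 003's degree-1 piece,
`= ∥℘posi(Ě)∥`) viewed as a `ρ^ℓ(O)`-submodule of `O`. K1.3's SECONDARY reading (PREREG-K1.3.md «R-flat»); NOT a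
statement of the manuscript. Always `bypassTFlat L0inf pposi ≤ bypassTFlatRFlat L0inf P1` is EXPECTED when `pposi`'s
degree-forgotten image lies in `P1`, but is not proved here. VACUITY: the meet of two parameters, not trivially `⊥`/`⊤`.
[folklore] -/
def bypassTFlatRFlat (L0inf : BlSub O p ℓ) (P1 : Ideal O) : Submodule (↥(iterateFrobenius O p ℓ).range) O :=
  S12GLUED.fnorm (↥(iterateFrobenius O p ℓ).range) L0inf ⊓ P1.restrictScalars (↥(iterateFrobenius O p ℓ).range)

/-- [OURS · L1 W1.3, reading R-flat] replaces the role of Def 13.2 Eq. (106) `Cot(Ě) = (𝔗♭(Ě) ∩ ρ^e(O))^{1/q}`,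
`q = p^e` (p.67 L20–L22) on the R-flat module: the `φ ∈ O` with `φ^{p^e} ∈ 𝔗♭_flat ∩ ρ^e(O)` — the same recipe as
row 015's `S13GLUEDDiagram.Cot` (preimage under `iterateFrobenius O p e` of the meet with `S13GLUEDDiagram.rhoPowSpan e`),
with `bypassTFlatRFlat` in place of `TFlat`. NOT a statement of the manuscript. [folklore] -/
def bypassCotRFlat (e : ℕ) (L0inf : BlSub O p ℓ) (P1 : Ideal O) : AddSubgroup O :=
  AddSubgroup.comap (iterateFrobenius O p e).toAddMonoidHom
    ((bypassTFlatRFlat L0inf P1).toAddSubgroup ⊓ (S13GLUEDDiagram.rhoPowSpan (ℓ := ℓ) e).toAddSubgroup)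

/-- Lattice sanity for the R-flat module: it lies inside `∥𝔏_0(∞)∥` (pure `inf_le_left`). [folklore] -/
theorem bypassTFlatRFlat_le (L0inf : BlSub O p ℓ) (P1 : Ideal O) :
    bypassTFlatRFlat L0inf P1 ≤ S12GLUED.fnorm (↥(iterateFrobenius O p ℓ).range) L0inf :=
  inf_le_left

/-! ## v3 (append-only): the R-flat reading with `P1 := ℘(Ě,1)` BOUND to the typed characteristic algebra

Everything above this line is byte-identical with v2 (p461895, sha16 6a29ef39aa95dcbb; OURS-DESK #7 CLOSED 11·11·11,
lane A res-L1-ref-a1 2026-08-26T19:25:39Z, lane B res-L1-ref-b3 19:22:43Z). Appended 2026-08-26 ~21:00Z by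
res-L1-type-o2 (g2) on four concordant lines: lane-A note (ii) of res-L1-ref-a1 19:25:39Z («in `bypassTFlatRFlat` the
ideal `P1` is a free parameter — the gloss ‹= ∥℘posi(Ě)∥› is not bound, so any campaign statement using the R-flat
reading must bind `P1 :=` the typed `℘(Ě,1)` explicitly»); kill test K1.3 = DEAD for the LITERAL degreewise reading
R-hom on all three examples B/C/D and «the candidate campaign reading is R-flat = `Campaign.bypassTFlatRFlat L0inf P1`
with `P1 := ℘(Ě,1)` bound explicitly» (res-L1-k13 2026-08-26T20:24:55Z / 20:26:27Z, evidence p466729 + job j259562,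
report L/res-L1-k13/KILL-TEST-K1.3.md); custody res-L1-dag-5 20:28:42Z; and the director's RULING 2026-08-26T20:36:49Z (2):
«the degree-forgetting reading R-flat is NON-PROPAGATING on B/C/D and is the s13 campaign reading — WAKE-s13 STANDS;
res-L1-s13-plan-1's CAMPAIGN.md must (a) state R-flat as THE reading, (b) make k13's ‹first obligation + second
disjoint check› its rung 1, (c) carry the dead literal lever in a ‹Dead levers› §». This section supplies (a)'s OBJECT
with the binding done in the term: `℘(Ě,j)` at ring level := the degree-`j` piece (row 003's `S04CharAlgebra.homogPiece`,
§4 p.16 L40–41) of the typed ALGEBRAIC characteristic algebra `S04CharAlgebra.pAlgebraicRing K O J b` (U17_2, p.17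
L8–L11: «℘(E) is the integral closure in Bl(Z)∗ of the graded O-subalgebra generated by … (Diff^{(j)}J)O ⊂ Bl(Z,b−j) for
all 0 ≤ j < b») of `Ě = (J, b)` on the section / stalk ring `O` — the same binding the G1 lead used for the R01 evidence
(HOME/ledger/evidence/R01/res-adj-1-G1Collapse.lean, `P3 a := homogPiece O3 (pAlgebraicRing (ZMod 3) O3 J3 2) a`). That
the algebraic `℘` equals the GEOMETRIC one (p.17 L1–L7, U17_1) is the manuscript's CANDIDATE U17_4 ([23], `K` perfect)
and is NOT used here; K1.3 certified its memberships from the geometric definition — a campaign statement that needs the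
geometric `℘` must say so. The campaign statement proper (rung 1: «`y(e)^q ∈ ℘(Ě,1)` for every LL-chain at every level»,
automatic at `e = 1`, not for `e ≥ 2` — k13; and the R-flat `Cot ∋ tails` / (125) / Def 15.8 (3) invariance on the stated
class) is res-L1-s13-plan-1's CAMPAIGN.md item, APPENDED here on its hand-over line; nothing below asserts it.
The dead literal lever stays typed above (`bypassTSharp`/`bypassTFlat`/`bypassCot`, reading R-hom) — (c) needs no new decl.
HONEST FRAMING as for v1/v2: OURS objects; NOT statements of the manuscript; no claim about resolution of
singularities; barrier of record for the slot `KangarooShadeIncrease.Hauser2003_kangarooShadeIncrease` (an R-flat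
NON-PROPAGATING finding still leaves L-G4 / (127) open); nearest decl to K1.3's death
`NarasimhanMaximalContact.NarasimhanMaximalContactNarrow_holds` (k13 §4). AI typing is weaker than expert review. -/

section RFlatBound

variable (K : Type v) [CommRing K] [Algebra K O]

/-- [OURS · L1 W1.3, plumbing for reading R-flat] `℘(Ě,j)` AT RING LEVEL, BOUND: the degree-`j` piece
(`S04CharAlgebra.homogPiece`, §4 p.16 L40–41 / Th 4.1 p.17 L20–22) of the typed ALGEBRAIC characteristic algebra
`S04CharAlgebra.pAlgebraicRing K O J b ⊆ O[X] = Bl∗` (row 003, U17_2 p.17 L8–L11) of the ideal exponent `Ě = (J, b)` on the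
`K`-algebra `O` (`O = O_Z(V)` or `O_{Z,ξ}`). A NAME for a composite of two typed row-003 decls (no new notion; cite row 003
for the content); replaces the role of the symbol `℘(Ě,j)` wherever an R-flat statement of this slot needs it bound
rather than passed as a free ideal. NOT a statement of the manuscript. VACUITY: a term, not a claim; `j = 0` gives the
degree-`0` piece, which is `O` automatically (the degree-`0` part of an `O`-subalgebra of `O[X]` containing `O`; no
candidate needed — lane B res-L1-ref-b3 2026-08-26T21:55:47Z), and is not used by the slot. [folklore] -/
def pAlgPiece (J : Ideal O) (b j : ℕ) : Ideal O :=
  S04CharAlgebra.homogPiece O (S04CharAlgebra.pAlgebraicRing K O J b) j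

/-- [OURS · L1 W1.3, reading R-flat, `P1` BOUND] replaces the role of Def 13.2 `𝔗♭(Ě) = ∥𝔗♯(Ě)∥ ⊂ O_Z` (p.67 L19)
under the bypass in the degree-forgetting order, with the positive-part ideal bound to the typed characteristic
algebra: `𝔗♭_flat(Ě) := ∥𝔏_0(∞)∥ ∩ ℘(Ě,1)` = `bypassTFlatRFlat L0inf (pAlgPiece K J b 1)` for `Ě = (J, b)` — exactly the
object of the director's ruling 2026-08-26T20:36:49Z (2) / res-L1-k13 20:26:27Z («`Campaign.bypassTFlatRFlat L0inf P1`
with `P1 := ℘(Ě,1)`»), answering lane-A note (ii) of 19:25:39Z. `L0inf` («𝔏_0(∞)», last module of diagram (104) p.67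
L4–L10) stays a parameter as in row 015. NOT a statement of the manuscript. VACUITY: not trivially `⊥`/`⊤` (meet of
`∥L0inf∥` with a generally proper ideal). [folklore] -/
def bypassTFlatRFlatAlg (J : Ideal O) (b : ℕ) (L0inf : BlSub O p ℓ) :
    Submodule (↥(iterateFrobenius O p ℓ).range) O :=
  bypassTFlatRFlat L0inf (pAlgPiece K J b 1)

/-- [OURS · L1 W1.3, reading R-flat, `P1` BOUND] replaces the role of Def 13.2 Eq. (106) `Cot(Ě) = (𝔗♭(Ě) ∩
ρ^e(O))^{1/q}`, `q = p^e` (p.67 L20–L22; consumed by Def 15.7 p.77 L24–L29, Def 15.8 (2)–(3) p.78 L8–L13, Eq. (125)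
p.78 L20–L22) on the bound R-flat module: `bypassCotRFlat e L0inf (pAlgPiece K J b 1)`. This is the `Cot` whose
containing-the-tails property on examples B/C/D kill test K1.3 reports UNCHANGED against baseline (res-L1-k13
20:24:55Z, «keep evidence»); whether it holds on the campaign's class is res-L1-s13-plan-1's rung 1 — NOT asserted here.
NOT a statement of the manuscript. [folklore] -/
def bypassCotRFlatAlg (e : ℕ) (J : Ideal O) (b : ℕ) (L0inf : BlSub O p ℓ) : AddSubgroup O :=
  bypassCotRFlat e L0inf (pAlgPiece K J b 1)

/-- Unfolding anchor (by `rfl`): the bound R-flat module is the v2 parametric one at `P1 := pAlgPiece K J b 1`.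
[folklore] -/
theorem bypassTFlatRFlatAlg_eq (J : Ideal O) (b : ℕ) (L0inf : BlSub O p ℓ) :
    bypassTFlatRFlatAlg K J b L0inf = bypassTFlatRFlat L0inf (pAlgPiece K J b 1) :=
  rfl

end RFlatBound

/-! ## v4 (append-only): RUNG 1 of the R-flat campaign — the tail-power condition «`y(e)^q ∈ ℘(Ě,1)`» and its
## bookkeeping against the bound cotangent module

Everything above this line is byte-identical with v3 (p468546, sha16 e49184cc62567ba6; OURS-DESK #7 → v3 CLOSED: lane A
res-L1-ref-a1 2026-08-26T21:44:25Z 15/15, lane B res-L1-ref-b3 21:55:47Z 15/15) except ONE added `import` line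
(`S09LLUED.R063Tails`, row 063: the LL-chain data carrier `LLChainData` of row 061 and its `tail`). Appended 2026-08-26 by
res-L1-type-o2 (g3). PROVENANCE. The director's RULING 2026-08-26T20:36:49Z (2) fixes the s13 campaign's reading (R-flat)
and its RUNG 1 = kill test K1.3's «first obligation + second disjoint check» (HOME/L/res-L1-k13/KILL-TEST-K1.3.md §4,
verbatim): «first obligation = POS in general (`y(e)^q ∈ ℘(Ě,1)` for every LL-chain at every level — automatic at level 1
when `H` is a multiple of a first Hasse derivative of `g`, NOT automatic for `e ≥ 2`). SECOND, DISJOINT CHECK before any S3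
use of the R-flat line: (a) Example A (`y²+x⁵`), the `p = 3` specimen R2, and one `e = 2` head (`q = 4`); (b) res-L1-repro-2
re-derivation of j259562». K1.3 §3 «Mechanism (R-flat): `Cot_flat = Cot_baseline ∩ {φ : φ^q ∈ ℘(Ě,1)}`; … every recomputed
tail passes it by POS (`H ∈ Diff¹(J)·O ⊂ ℘(Ě,1)`, F-20a)». This section NAMES the first obligation as `Prop` SCHEMAS with
every datum explicit, in the conventions of the typed rows it meets — row 061/063 (`S09LLUED.LLChainData`, `.tail`,
`.IsLLChainAt` / `.IsLLChainAt_ours`, stalk level, local ring `O = O_{Z,ξ}` UNBUNDLED), row 081 (`S14LocalGlobal.Thm14_2`: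
«any LL-chain headed by `g(0)`» = a chain PREDICATE passed as a parameter; (107) `ρ^i(g(i)) ∈ ∥𝔏_{e−i}(∞)∥`) — and records,
as pure unfoldings of v2/v3's definitions, WHAT the condition buys: membership of the tail in the bound R-flat cotangent
module `bypassCotRFlatAlg` is EXACTLY «(107) at `i = e`» ∧ «POS» (`tail_mem_bypassCotRFlatAlg_iff`). The campaign
statement proper — POS on a stated CLASS of ideal exponents and chains (which `⊟(g,a)`-filler, which `℘̃`, which reading
of (83)/(84)), the instances of the second check (a), and the invariance of résumé / (125) / Def 15.8 (3) on that class —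
is res-L1-s13-plan-1's CAMPAIGN.md item (not seated at the time of writing; res-L1-s13-pv-1 STARTED 19:55:08Z); it is
APPENDED here or closed over these schemas on its hand-over line; NOTHING below asserts it. WHY TYPED NOW, ahead of that
hand-over (as v1 was typed ahead for K1.3): the director's RULING 2026-08-26T22:46:50Z («W1.2 = lever DEAD · variant V1
without consumer ⇒ S-s12 HELD … G1 LIVE L CAPACITY = W1.3 R-flat (s13) ONLY») leaves this rung as G1's only live repair
work, and its statement is already fixed by the 20:36:49Z ruling — so the named, lane-signable schema is supplied for
whichever s13 seat proves against it (two-lane rule, L/README §3). WHICH `℘`: as in v3, `℘(Ě,1)`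
is BOUND to the typed ALGEBRAIC characteristic algebra (row 003 U17_2, `pAlgPiece K J b 1`); K1.3's POS certificates
(p466729 `Campaign.K13.D_pos`, `C_pos`) were derived for the GEOMETRIC `℘` via F-20a — the identification is the
manuscript's CANDIDATE U17_4 ([23], `K` perfect), NOT a premise here (lane-B consumer note res-L1-ref-b3 2026-08-26T21:55:47Z);
a campaign statement wanting the geometric `℘` says so. HONEST FRAMING as for v1–v3: OURS statements about OUR objects;
NOT statements of the manuscript; no claim about resolution of singularities; barrier of record for the slot
`KangarooShadeIncrease.Hauser2003_kangarooShadeIncrease` (R-flat NON-PROPAGATING would still leave L-G4 / (127) open).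
AI typing is weaker than expert review.

v5 (2026-08-27, res-L1-type-o2 g4; APPEND-ONLY over v4 p473358 sha16 a358c97b0214781a — every v4 Lean term byte-identical):
(A) ONE new decl, section `RungOneClosed` at the end: `CampaignW13RFlatTailPowDiffKnockOut p K J b` = the CLOSED rung-1 Prop on
the class `𝒞_Diff` («the total knock-out `g(0) − y(e)^q` is a value of `K`-linear differential operators of order `< b` on
`J`»), typed VERBATIM from the hand-over of the slot's prover res-L1-s13-pv-1 (STATUS 2026-08-27T00:50:13Z, answering the
typer's OFFER 2026-08-26T23:49:55Z (a); (b) geometric-`℘` sibling: dropped as not needed; (c) résumé/(125) readers: after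
s13-plan-1's CAMPAIGN.md); (B) three docstring LOCATOR / WORDING corrections owed since v3/v4, no term touched — (i) v2
section: Th 4.5's STATEMENT is layout p.18 L7–L8 (L9–L14 = its proof; res-L1-ref-b3 2026-08-26T21:55:47Z nit (ii)); (ii)
`pAlgPiece`: the degree-`0` piece is `O` automatically, no candidate needed (b3 nit (i)); (iii) `RFlatTailPow`: Def 9.21 is
layout p.56 L25–L26 (self-reported 2026-08-26T23:17:48Z). -/

section RungOne

open Literature.AlgebraicGeometry.Hironaka2017.S09LLUED (LLChainData)

variable (p) (K : Type v) [CommRing K] [Algebra K O]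

/-- [OURS · L1 W1.3, rung 1, reading R-flat] the TAIL-POWER CONDITION «POS» of kill test K1.3 for ONE LL-chain datum:
`y(e)^q ∈ ℘(Ě,1)`, `q = p^e` — the `p^e`-th power of the tail `g(e) = y(e)` (row 063 `LLChainData.tail d = d.g d.e`,
Def 9.20 p.56 L6–L7, Def 9.21 p.56 L25–L26; (84)(7) p.55) lies in the degree-`1` piece of the characteristic algebra of `Ě = (J, b)`
(BOUND, algebraic: `pAlgPiece K J b 1`, v3). Replaces the role — for the R-flat tails module `∥𝔏_0(∞)∥ ∩ ℘(Ě,1)` — of the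
membership the printed `℘nega` knock-outs supply in Th 14.2 Eq. (108) p.69 L7–L8 («`g ∈ 𝔗(Ě)`», typed row 081
`S14LocalGlobal.Thm14_2_eq108_mem` / `_mem_ours`): K1.3 §3 «the membership of the LL-tail's `q`-th power in the tails
module is carried precisely by the negative-degree knock-outs; … Mechanism (R-flat): `Cot_flat = Cot_baseline ∩
{φ : φ^q ∈ ℘(Ě,1)}`». NOT a statement of the manuscript (no printed sentence says «`y(e)^q ∈ ℘(Ě,1)`»); stated, not
claimed. VACUITY: neither trivially true nor false as typed — K1.3 certifies it on examples B/C/D at `e = 1` (`y² =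
g − x₁·∂_{x₁}g` etc., p466729 `D_pos`/`C_pos`, geometric `℘`) and records it «NOT automatic for `e ≥ 2`»
(`y(e)^{p^e} = g(0) − Σ_{j<e} h(j)^{p^j}` by (84)(1), each `h(j)` only in `⊟(g(j), p^{e−j})`). [folklore] -/
def RFlatTailPow (J : Ideal O) (b : ℕ) (d : LLChainData O) : Prop :=
  d.tail ^ (p ^ d.e) ∈ pAlgPiece K J b 1

/-- Anchor: «`y(e)^q`» is the `e`-fold Frobenius `ρ^e` applied to the tail (Mathlib `iterateFrobenius_def`), the form in
which Th 14.2 (107) p.69 L2–L3 («`ρ^i(g(i)) ∈ ∥𝔏_{e−i}(∞)∥`», row 081 `Thm14_2_eq107`) and Def 13.2 (106) speak. [folklore] -/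
theorem rFlatTailPow_iff (J : Ideal O) (b : ℕ) (d : LLChainData O) :
    RFlatTailPow p K J b d ↔ iterateFrobenius O p d.e d.tail ∈ pAlgPiece K J b 1 := by
  rw [RFlatTailPow, iterateFrobenius_def]

/-- [OURS · L1 W1.3, rung 1, reading R-flat] «POS for EVERY LL-chain» at the point `ξ` (`O = O_{Z,ξ}`) for `Ě = (J, b)`:
every chain datum satisfying the chain predicate `IsLLChain` has the tail-power property. The predicate is a PARAMETER
exactly as in row 081's `S14LocalGlobal.Thm14_2` («Pick any LL-chain headed by `g(0)` at `ξ`»): the campaign instantiates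
it with row 061's `fun d => d.IsLLChainAt p D boxminus pTilde IsDiffProductOf` (Eq. (83)+(84) AS PRINTED, headed by the
Eq. (82) datum `D`) or with the OURS reading `d.IsLLChainAt_ours …` (lane B's rigidity note: the as-printed conjunction
forces a degenerate chain over a domain), and BINDS row 061's free parameters — `boxminus` = `⊟(g,a)` filled by the
`H♭`-products of §9.5–9.7 (rows 047/057; no numbered printed definition), `pTilde` = `℘̃(Ě)_ξ`, `IsDiffProductOf` — on the
class it states; with `boxminus` unconstrained the closed ∀-statement is NOT the intended one (typer's check, no
side taken: on example D = (`y²+x₁x₂³`, 2), `p = 2`, `e = 1`, the «knock-out» `h(0) := x₁x₂³ + x₁⁴` has the printed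
order `λ(0) = 4 > q` and gives, under the `_ours` reading of (83)(7), the chain tail `y + x₁²` with `(y + x₁²)² = g +
x₁x₂³ + x₁⁴ ∉ ℘(Ě,1)` because the algebraic `℘(Ě,1) ⊆ (y, x₂)` while K1.3's genuine `H♭ = x₁x₂³` gives `y² ∈ ℘(Ě,1)`),
so NO closed form is typed here. «At every level» (K1.3 §4) = for every `e ≥ 1` (`q = p^e`; the datum carries its own
`d.e`). NOT a statement of the manuscript; stated, not claimed.
VACUITY: as for `RFlatTailPow`; trivially true for an empty predicate — the campaign's class must be inhabited (K1.3's
B/C/D heads; second check (a): Example A `y²+x⁵`, the `p = 3` specimen R2, one `e = 2` head). [folklore] -/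
def RFlatTailPowOn (J : Ideal O) (b : ℕ) (IsLLChain : LLChainData O → Prop) : Prop :=
  ∀ d : LLChainData O, IsLLChain d → RFlatTailPow p K J b d

variable {p K}

/-- Bookkeeping (pure unfolding of v2's `bypassCotRFlat`, no content): an element `φ ∈ O` lies in the R-flat cotangent
module `Cot_flat = ((∥𝔏_0(∞)∥ ∩ P1) ∩ ρ^e(O))^{1/p^e}` iff `ρ^e(φ) ∈ ∥𝔏_0(∞)∥` and `ρ^e(φ) ∈ P1` — the conjunct
`ρ^e(φ) ∈ ρ^e(O)·ρ^ℓ(O)` (row 015 `rhoPowSpan`) being automatic for a `p^e`-th power. [folklore] -/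
theorem mem_bypassCotRFlat_iff (e : ℕ) (L0inf : BlSub O p ℓ) (P1 : Ideal O) (φ : O) :
    φ ∈ bypassCotRFlat e L0inf P1 ↔
      iterateFrobenius O p e φ ∈ S12GLUED.fnorm (↥(iterateFrobenius O p ℓ).range) L0inf ∧
        iterateFrobenius O p e φ ∈ P1 := by
  have hρ : iterateFrobenius O p e φ ∈ S13GLUEDDiagram.rhoPowSpan (O := O) (p := p) (ℓ := ℓ) e :=
    Submodule.subset_span (Set.mem_range_self φ)
  simp only [bypassCotRFlat, bypassTFlatRFlat, AddSubgroup.mem_comap, AddSubgroup.mem_inf,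
    Submodule.mem_toAddSubgroup, Submodule.mem_inf, Submodule.restrictScalars_mem, RingHom.toAddMonoidHom_eq_coe,
    AddMonoidHom.coe_coe]
  exact ⟨fun h => ⟨h.1.1, h.1.2⟩, fun h => ⟨⟨h.1, h.2⟩, hρ⟩⟩

variable (K)

/-- [OURS · L1 W1.3, rung 1 — what POS buys, by unfolding] «`Cot_flat ∋ tail` ⟺ (107)_{i=e} ∧ POS»: the tail `y(e)` of a
chain datum lies in the BOUND R-flat cotangent module `bypassCotRFlatAlg K e J b L0inf` (v3; Def 13.2 (106) p.67 L20–L22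
on `∥𝔏_0(∞)∥ ∩ ℘(Ě,1)`) at its own level `e = d.e` if and only if `ρ^e(y(e)) ∈ ∥𝔏_0(∞)∥` — the `i = e` instance of
Th 14.2 (107) p.69 L2–L3 (row 081 `Thm14_2_eq107` with `normLinf 0 = ∥𝔏_0(∞)∥`, a CANDIDATE, consumed only as a
hypothesis) — AND `RFlatTailPow` holds. This is K1.3 §3's «`Cot_flat = Cot_baseline ∩ {φ : φ^q ∈ ℘(Ě,1)}`» for the bound
module, and the exact place where rung 1 feeds the résumé / Def 15.8 (3) / (125) readers of `Cot` downstream (rows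
090/091, `S15ARSchemes.Def15_7` / `Def15_8` / `Eq125` — not touched here). OURS bookkeeping about OUR objects; NOT a
statement of the manuscript. [folklore] -/
theorem tail_mem_bypassCotRFlatAlg_iff (J : Ideal O) (b : ℕ) (L0inf : BlSub O p ℓ) (d : LLChainData O) :
    d.tail ∈ bypassCotRFlatAlg K d.e J b L0inf ↔
      iterateFrobenius O p d.e d.tail ∈ S12GLUED.fnorm (↥(iterateFrobenius O p ℓ).range) L0inf ∧
        RFlatTailPow p K J b d := by
  rw [bypassCotRFlatAlg, mem_bypassCotRFlat_iff, rFlatTailPow_iff, pAlgPiece]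

end RungOne

/-! ## v5 — rung 1 CLOSED on the class `𝒞_Diff` (hand-over res-L1-s13-pv-1 2026-08-27T00:50:13Z) -/

section RungOneClosed

open Literature.AlgebraicGeometry.Hironaka2017.S09LLUED (LLChainData)

variable (p) (K : Type v) [CommRing K] [Algebra K O]

/-- [OURS · L1 W1.3, rung 1 — THE CLOSED CAMPAIGN PROP on the class `𝒞_Diff`, reading R-flat, `℘` BOUND (algebraic)]
replaces the role — for the R-flat tails module `∥𝔏_0(∞)∥ ∩ ℘(Ě,1)` — of the membership Th 14.2 Eq. (108) p.69 L7–L8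
(«`g ∈ 𝔗(Ě)`», row 081 `S14LocalGlobal.Thm14_2_eq108_mem`) draws from the printed `℘nega` knock-outs: `RFlatTailPowOn` (v4)
INSTANTIATED at the class predicate `𝒞_Diff d :≡ d.g 0 ∈ J ∧ ∃ j < b, d.g 0 − d.tail^(p^d.e) ∈ Diff^{(j)}_K(J)` — «R-flat
keeps every LL-tail whose TOTAL KNOCK-OUT `g(0) − y(e)^q` (by (84)(1) p.55, `y(e)^{p^e} = g(0) − Σ_{j<e} h(j)^{p^j}`) is a
value of `K`-linear differential operators of order `< b` on `J`» (tree `Resolution.diffIdeal K j J`, §3.1.1 p.7). Typed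
VERBATIM from the slot prover's hand-over (res-L1-s13-pv-1, STATUS 2026-08-27T00:50:13Z (a)); explicit binders `p K J b`
(the two-lane rule's lesson p468289: no closed Prop without them). NOT a statement of the manuscript (no printed sentence
names `𝒞_Diff`); stated, not claimed here. VACUITY — HONEST: this Prop is PROVABLE for every `(p, K, O, J, b)`: at `b = 0`
the class is empty (`∃ j < 0`); at `b ≥ 1` it is res-L1-s13-pv-1's `Campaign.W13.pow_mem_pAlgPiece_one_of_sub_mem_diffIdeal`
(p475548 §5: `Diff^{(j)}(J)·X^{b−j}` are generators of row 003's carrier, so `Diff^{(j)}(J) ⊆ ℘(Ě,1)` by construction) —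
i.e. `𝒞_Diff` is BY DESIGN the class the R-flat reading retains, and the rung closes BY NAME with a one-line `_holds`.
The CONTENT of rung 1 is therefore NOT this Prop's truth but the MEMBERSHIP of the campaign's chains in `𝒞_Diff`
(instances A/B/C/D, the `p = 3` specimen R2, the `e = 2` head E2: p478130 / p479454, s13-pv-1) and the census of
§9.7-recipe chains falling OUTSIDE `𝒞_Diff` (kit j263239; the recipe-bound target `𝒞_rec = IsLLChainAt_ours + ⊟ := row 057
HFlat.op` stays with res-L1-s13-plan-1, see L/res-L1-type-o2/W13-RUNG1-TYPING-MEMO.md §2). Lanes: sign it as the NAME of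
the retained class + its closure under the v4 schema, not as a claim about LL-chains. [folklore] -/
def CampaignW13RFlatTailPowDiffKnockOut (J : Ideal O) (b : ℕ) : Prop :=
  RFlatTailPowOn p K J b fun d =>
    d.g 0 ∈ J ∧ ∃ j < b, d.g 0 - d.tail ^ (p ^ d.e) ∈ Literature.AlgebraicGeometry.Resolution.diffIdeal K j J

omit [Fact p.Prime] [CharP O p] in
/-- Unfolding anchor (by `Iff.rfl`), so a prover closes the rung against the literal ∀-form: the closed Prop says that
every chain datum whose head `g(0)` lies in `J` and whose total knock-out lies in some `Diff^{(j)}(J)`, `j < b`, has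
`y(e)^{p^e} ∈ ℘(Ě,1)` (`RFlatTailPow`, v4). [folklore] -/
theorem campaignW13RFlatTailPowDiffKnockOut_iff (J : Ideal O) (b : ℕ) :
    CampaignW13RFlatTailPowDiffKnockOut p K J b ↔
      ∀ d : LLChainData O, (d.g 0 ∈ J ∧ ∃ j < b,
        d.g 0 - d.tail ^ (p ^ d.e) ∈ Literature.AlgebraicGeometry.Resolution.diffIdeal K j J) →
          RFlatTailPow p K J b d :=
  Iff.rfl

end RungOneClosed

end Summit.ResolutionOfSingularities.ResolutionOfSingularities.Theorems.Campaign
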